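import Literature.AlgebraicGeometry.Morphisms.CechModuleExact
import HarnessLib

/-!
# The Čech complex of a sheaf of modules in degree `2`: `Ȟ²(𝒰, M)`, and exactness of the long
# exact sequence at `Ȟ¹(𝒰, M″)`

Sequel of `Literature/AlgebraicGeometry/Morphisms/CechModule.lean` (Čech complex of an
`𝒪_X`-module `M` on a family of opens `𝒰 = (U_i)` of an `A`-scheme `f : X → Spec A` in degrees
`≤ 2`, `Ȟ⁰`, `Ȟ¹`) and `CechModuleExact.lean` (the long exact Čech sequence of a sectionwise exact
`M′ —φ→ M —ψ→ M″` up to exactness at `Ȟ¹(𝒰, M)`; its docstring: "beyond `Ȟ¹(M)` (which needs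
`Ȟ²`) deliberately not treated").  This file adds the degree-`2` layer and the next exactness:

* `CechMC3`, `cechMD2` — `3`-cochains `Č³(𝒰, M) = Π_{i,j,k,l} Γ(U_i ∩ U_j ∩ U_k ∩ U_l, M)` and the
  differential `d² : Č² → Č³`, `(d² e)_{ijkl} = e_{jkl}| - e_{ikl}| + e_{ijl}| - e_{ijk}|`, with
  `d² ∘ d¹ = 0` (`cechMD2_cechMD1`);
* `cechMZ2`, `cechMB2`, `CechMH2` — `2`-cocycles, `2`-coboundaries and **`Ȟ²(𝒰, M) = Ž²/B̌²`**, an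
  `A`-module; `cechMapC3`, `cechMD2_mapC2`, `cechMapZ2`, `cechMapH2` — functoriality in `M`;
* `CechExactData.exists_cechMapH1_eq_of_cechMZ2_le` — **exactness at `Ȟ¹(𝒰, M″)` when
  `Ȟ²(𝒰, M′) = 0`**: if `M′ —φ→ M —ψ→ M″` is sectionwise exact (`CechExactData`), `ψ` is moreover
  surjective on the sections over the pairwise intersections `U_i ∩ U_j` (true for `U_i` affine
  with affine pairwise intersections — e.g. `X` separated — and `M′` quasi-coherent, by
  `app_surjective_of_shortExact` of `CechModuleShortExact.lean`), and every `2`-cocycle of `M′` on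
  `𝒰` is a `2`-coboundary, then `Ȟ¹(𝒰, M) → Ȟ¹(𝒰, M″)` is SURJECTIVE (lift a cocycle `z″` to a
  cochain `c` of `M`; `d¹ c = φ e′` with `e′` a `2`-cocycle of `M′`, `e′ = d¹ c′`; then `c - φ c′`
  is a cocycle of `M` over `z″`) — the standard diagram chase of the long exact sequence of the
  short exact sequence of Čech complexes (Hartshorne III, proof of Thm. 4.5); `cechMapH1_surjective_of_subsingleton_cechMH2` — the same with `Ȟ²(𝒰, M′)`
  subsingleton.

This is the form in which "`H²(X, 𝓕′) = 0`" is used: RIGHT EXACTNESS of `H¹` on short exact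
sequences (e.g. on a scheme proper over an affine base with fibres of dimension `≤ 1`,
EGA III (4.2.2)).  Everything is proved; no named facts.  Mathlib searched (pin v4.32): no Čech
cohomology of sheaves of modules on schemes (cf. `CechModule.lean`).

## References

* R. Hartshorne, *Algebraic Geometry*, GTM 52, Springer (1977): III §4, proof of Thm. 4.5 (p. 222).
  [Hartshorne1977]
* The Stacks Project, Tag 01ED (Cohomology, Section 20.9: the Čech complex). [StacksProject]
-/

noncomputable section

open CategoryTheory AlgebraicGeometry Limits TopologicalSpace Opposite

universe u v

namespace Literature.AlgebraicGeometry.Morphisms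

variable {A : Type u} [CommRing A] {X : Scheme.{u}} (f : X ⟶ Spec (.of A)) (M : X.Modules)

/-! ## The Čech complex of `M` in degree `3` and `Ȟ²` -/

section Cech

variable {ι : Type v} (U : ι → X.Opens)

/-- Čech `3`-cochains `Č³(𝒰, M) = Π_{i,j,k,l} Γ(U_i ∩ U_j ∩ U_k ∩ U_l, M)` (all ordered quadruples).
[cite: StacksProject, Tag 01ED (Cohomology, Section 20.9)] -/
abbrev CechMC3 : Type (max u v) := (i j k l : ι) → MSections f M (U i ⊓ U j ⊓ U k ⊓ U l)

/-- `U_i ∩ U_j ∩ U_k ∩ U_l ⊆ U_j ∩ U_k ∩ U_l`. [folklore] -/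
private theorem inf₄_le_jkl (i j k l : ι) : U i ⊓ U j ⊓ U k ⊓ U l ≤ U j ⊓ U k ⊓ U l :=
  le_inf (le_inf (inf_le_left.trans (inf_le_left.trans inf_le_right))
    (inf_le_left.trans inf_le_right)) inf_le_right

/-- `U_i ∩ U_j ∩ U_k ∩ U_l ⊆ U_i ∩ U_k ∩ U_l`. [folklore] -/
private theorem inf₄_le_ikl (i j k l : ι) : U i ⊓ U j ⊓ U k ⊓ U l ≤ U i ⊓ U k ⊓ U l :=
  le_inf (le_inf (inf_le_left.trans (inf_le_left.trans inf_le_left))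
    (inf_le_left.trans inf_le_right)) inf_le_right

/-- `U_i ∩ U_j ∩ U_k ∩ U_l ⊆ U_i ∩ U_j ∩ U_l`. [folklore] -/
private theorem inf₄_le_ijl (i j k l : ι) : U i ⊓ U j ⊓ U k ⊓ U l ≤ U i ⊓ U j ⊓ U l :=
  le_inf (inf_le_left.trans inf_le_left) inf_le_right

/-- `U_i ∩ U_j ∩ U_k ∩ U_l ⊆ U_i ∩ U_j ∩ U_k`. [folklore] -/
private theorem inf₄_le_ijk (i j k l : ι) : U i ⊓ U j ⊓ U k ⊓ U l ≤ U i ⊓ U j ⊓ U k :=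
  inf_le_left

/-- The Čech differential `d² : Č² → Č³`,
`(d² e)_{ijkl} = e_{jkl}| - e_{ikl}| + e_{ijl}| - e_{ijk}|`.
[cite: StacksProject, Tag 01ED (Cohomology, Section 20.9)] -/
def cechMD2 : CechMC2 f M U →ₗ[A] CechMC3 f M U where
  toFun e i j k l :=
    MSections.res f M (inf₄_le_jkl U i j k l) (e j k l) -
      MSections.res f M (inf₄_le_ikl U i j k l) (e i k l) +
        MSections.res f M (inf₄_le_ijl U i j k l) (e i j l) -
          MSections.res f M (inf₄_le_ijk U i j k l) (e i j k)
  map_add' e e' := by ext i j k l; simp only [Pi.add_apply, map_add]; abel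
  map_smul' a e := by
    ext i j k l
    simp only [Pi.smul_apply, map_smul, RingHom.id_apply, smul_sub, smul_add]

/-- Unfolding of `cechMD2`. [cite: StacksProject, Tag 01ED (Cohomology, Section 20.9)] -/
theorem cechMD2_apply (e : CechMC2 f M U) (i j k l : ι) :
    cechMD2 f M U e i j k l =
      MSections.res f M (inf₄_le_jkl U i j k l) (e j k l) -
        MSections.res f M (inf₄_le_ikl U i j k l) (e i k l) +
          MSections.res f M (inf₄_le_ijl U i j k l) (e i j l) -
            MSections.res f M (inf₄_le_ijk U i j k l) (e i j k) :=
  rfl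

/-- `d² ∘ d¹ = 0`. [cite: StacksProject, Tag 01ED (Cohomology, Section 20.9)] -/
theorem cechMD2_cechMD1 (c : CechMC1 f M U) : cechMD2 f M U (cechMD1 f M U c) = 0 := by
  ext i j k l
  simp only [cechMD2_apply, cechMD1_apply, map_sub, map_add, MSections.res_res, Pi.zero_apply]
  have hij : U i ⊓ U j ⊓ U k ⊓ U l ≤ U i ⊓ U j := inf_le_left.trans inf_le_left
  have hik : U i ⊓ U j ⊓ U k ⊓ U l ≤ U i ⊓ U k :=
    le_inf (hij.trans inf_le_left) (inf_le_left.trans inf_le_right)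
  have hil : U i ⊓ U j ⊓ U k ⊓ U l ≤ U i ⊓ U l := le_inf (hij.trans inf_le_left) inf_le_right
  have hjk : U i ⊓ U j ⊓ U k ⊓ U l ≤ U j ⊓ U k :=
    le_inf (hij.trans inf_le_right) (inf_le_left.trans inf_le_right)
  have hjl : U i ⊓ U j ⊓ U k ⊓ U l ≤ U j ⊓ U l := le_inf (hij.trans inf_le_right) inf_le_right
  have hkl : U i ⊓ U j ⊓ U k ⊓ U l ≤ U k ⊓ U l :=
    le_inf (inf_le_left.trans inf_le_right) inf_le_right
  rw [MSections.res_eq_res f M _ hij (c i j), MSections.res_eq_res f M _ hik (c i k),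
    MSections.res_eq_res f M _ hil (c i l), MSections.res_eq_res f M _ hjk (c j k),
    MSections.res_eq_res f M _ hjl (c j l), MSections.res_eq_res f M _ hkl (c k l)]
  abel

/-- Čech `2`-cocycles `Ž²(𝒰, M) = ker d²`. [cite: StacksProject, Tag 01ED (Cohomology, Section 20.9)] -/
def cechMZ2 : Submodule A (CechMC2 f M U) := LinearMap.ker (cechMD2 f M U)

/-- Čech `2`-coboundaries `B̌²(𝒰, M) = im d¹`.
[cite: StacksProject, Tag 01ED (Cohomology, Section 20.9)] -/
def cechMB2 : Submodule A (CechMC2 f M U) := LinearMap.range (cechMD1 f M U)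

/-- Membership in `Ž²`. [cite: StacksProject, Tag 01ED (Cohomology, Section 20.9)] -/
theorem mem_cechMZ2_iff (e : CechMC2 f M U) : e ∈ cechMZ2 f M U ↔ cechMD2 f M U e = 0 :=
  LinearMap.mem_ker

/-- Membership in `B̌²`. [cite: StacksProject, Tag 01ED (Cohomology, Section 20.9)] -/
theorem mem_cechMB2_iff (e : CechMC2 f M U) : e ∈ cechMB2 f M U ↔ ∃ c, cechMD1 f M U c = e :=
  LinearMap.mem_range

/-- `B̌² ⊆ Ž²` (`d² ∘ d¹ = 0`). [cite: StacksProject, Tag 01ED (Cohomology, Section 20.9)] -/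
theorem cechMB2_le_cechMZ2 : cechMB2 f M U ≤ cechMZ2 f M U := by
  rintro e ⟨c, rfl⟩
  exact cechMD2_cechMD1 f M U c

/-- **`Ȟ²(𝒰, M) = Ž² / B̌²`**, the second Čech cohomology of the sheaf of modules `M` with respect
to the family of opens `U`, an `A`-module.
[cite: StacksProject, Tag 01ED (Cohomology, Section 20.9)] -/
abbrev CechMH2 : Type (max u v) :=
  ↥(cechMZ2 f M U) ⧸ (cechMB2 f M U).comap (cechMZ2 f M U).subtype

/-- The class of a `2`-cocycle in `Ȟ²(𝒰, M)`. [cite: StacksProject, Tag 01ED (Cohomology, Section 20.9)] -/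
def CechMH2.mk : ↥(cechMZ2 f M U) →ₗ[A] CechMH2 f M U := Submodule.mkQ _

/-- `CechMH2.mk` is surjective. [cite: StacksProject, Tag 01ED (Cohomology, Section 20.9)] -/
theorem CechMH2.mk_surjective : Function.Surjective (CechMH2.mk f M U) :=
  Submodule.mkQ_surjective _

/-- A `2`-cocycle has class `0` iff it is a `2`-coboundary. [cite: StacksProject, Tag 01ED (Cohomology, Section 20.9)] -/
theorem CechMH2.mk_eq_zero_iff (z : cechMZ2 f M U) :
    CechMH2.mk f M U z = 0 ↔ (z : CechMC2 f M U) ∈ cechMB2 f M U := by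
  rw [CechMH2.mk, Submodule.mkQ_apply, Submodule.Quotient.mk_eq_zero, Submodule.mem_comap]
  rfl

/-- Two `2`-cocycles have the same class iff they differ by a `2`-coboundary.
[cite: StacksProject, Tag 01ED (Cohomology, Section 20.9)] -/
theorem CechMH2.mk_eq_mk_iff (z z' : cechMZ2 f M U) :
    CechMH2.mk f M U z = CechMH2.mk f M U z' ↔ (z : CechMC2 f M U) - z' ∈ cechMB2 f M U := by
  rw [CechMH2.mk, Submodule.mkQ_apply, Submodule.mkQ_apply, Submodule.Quotient.eq,
    Submodule.mem_comap]
  rfl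

/-- `Ȟ²(𝒰, M)` is zero iff every `2`-cocycle is a `2`-coboundary. [cite: StacksProject, Tag 01ED (Cohomology, Section 20.9)] -/
theorem subsingleton_cechMH2_iff :
    Subsingleton (CechMH2 f M U) ↔ cechMZ2 f M U ≤ cechMB2 f M U := by
  constructor
  · intro h e he
    have := (CechMH2.mk_eq_zero_iff f M U ⟨e, he⟩).mp (Subsingleton.elim _ _)
    exact this
  · intro h
    refine ⟨fun x y => ?_⟩
    obtain ⟨z, rfl⟩ := CechMH2.mk_surjective f M U x
    obtain ⟨z', rfl⟩ := CechMH2.mk_surjective f M U y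
    rw [CechMH2.mk_eq_mk_iff]
    exact h (Submodule.sub_mem _ z.2 z'.2)

end Cech

/-! ## Functoriality in the sheaf of modules, degree `2` -/

section Map

variable {M} {N : X.Modules} (φ : M ⟶ N) {ι : Type v} (U : ι → X.Opens)

/-- `φ` on `3`-cochains. [cite: StacksProject, Tag 01ED (Cohomology, Section 20.9)] -/
def cechMapC3 : CechMC3 f M U →ₗ[A] CechMC3 f N U where
  toFun g i j k l := MSections.app f φ _ (g i j k l)
  map_add' g g' := by ext i j k l; simp only [Pi.add_apply, map_add]
  map_smul' a g := by ext i j k l; simp only [Pi.smul_apply, map_smul, RingHom.id_apply]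

/-- Unfolding of `cechMapC3`. [cite: StacksProject, Tag 01ED (Cohomology, Section 20.9)] -/
@[simp]
theorem cechMapC3_apply (g : CechMC3 f M U) (i j k l : ι) :
    cechMapC3 f φ U g i j k l = MSections.app f φ _ (g i j k l) := rfl

/-- `φ` commutes with `d²`. [cite: StacksProject, Tag 01ED (Cohomology, Section 20.9)] -/
theorem cechMD2_mapC2 (e : CechMC2 f M U) :
    cechMD2 f N U (cechMapC2 f φ U e) = cechMapC3 f φ U (cechMD2 f M U e) := by
  funext i j k l
  simp only [cechMD2_apply, cechMapC2_apply, cechMapC3_apply, map_sub, map_add, MSections.res_app]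

/-- `φ` maps `2`-cocycles to `2`-cocycles. [cite: StacksProject, Tag 01ED (Cohomology, Section 20.9)] -/
theorem mapC2_mem_cechMZ2 {e : CechMC2 f M U} (he : e ∈ cechMZ2 f M U) :
    cechMapC2 f φ U e ∈ cechMZ2 f N U := by
  rw [mem_cechMZ2_iff] at he ⊢
  rw [cechMD2_mapC2, he, map_zero]

/-- `φ` maps `2`-coboundaries to `2`-coboundaries. [cite: StacksProject, Tag 01ED (Cohomology, Section 20.9)] -/
theorem mapC2_mem_cechMB2 {e : CechMC2 f M U} (he : e ∈ cechMB2 f M U) :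
    cechMapC2 f φ U e ∈ cechMB2 f N U := by
  rw [mem_cechMB2_iff] at he ⊢
  obtain ⟨c, rfl⟩ := he
  exact ⟨cechMapC1 f φ U c, cechMD1_mapC1 f φ U c⟩

/-- `φ` on `2`-cocycles. [cite: StacksProject, Tag 01ED (Cohomology, Section 20.9)] -/
def cechMapZ2 : ↥(cechMZ2 f M U) →ₗ[A] ↥(cechMZ2 f N U) :=
  (cechMapC2 f φ U).restrict fun _ he => mapC2_mem_cechMZ2 f φ U he

/-- Unfolding of `cechMapZ2`. [cite: StacksProject, Tag 01ED (Cohomology, Section 20.9)] -/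
@[simp]
theorem cechMapZ2_coe (z : cechMZ2 f M U) :
    (cechMapZ2 f φ U z : CechMC2 f N U) = cechMapC2 f φ U z := rfl

/-- **`Ȟ²(𝒰, φ) : Ȟ²(𝒰, M) → Ȟ²(𝒰, N)`.** [cite: StacksProject, Tag 01ED (Cohomology, Section 20.9)] -/
def cechMapH2 : CechMH2 f M U →ₗ[A] CechMH2 f N U :=
  Submodule.mapQ _ _ (cechMapZ2 f φ U) fun z hz => by
    rw [Submodule.mem_comap] at hz ⊢
    exact mapC2_mem_cechMB2 f φ U hz

/-- `Ȟ²(φ)[z] = [φ z]`. [cite: StacksProject, Tag 01ED (Cohomology, Section 20.9)] -/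
@[simp]
theorem cechMapH2_mk (z : cechMZ2 f M U) :
    cechMapH2 f φ U (CechMH2.mk f M U z) = CechMH2.mk f N U (cechMapZ2 f φ U z) := rfl

end Map

/-! ## Exactness of the long exact sequence at `Ȟ¹(𝒰, M″)` -/

section Exact

variable {ι : Type v} (U : ι → X.Opens) {M' M M'' : X.Modules} (φ : M' ⟶ M) (ψ : M ⟶ M'')

/-- If `φ` is injective on sections and `φ e' = d¹ c` for a `1`-cochain `c` of `M`, then `e'` is a
`2`-cocycle of `M'` (apply `φ` to `d² e'` and use `d² d¹ = 0`).
[cite: Hartshorne1977, III Thm. 4.5 proof p. 222 (PDF p. 278)] -/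
theorem mem_cechMZ2_of_mapC2_eq_cechMD1
    (hinj : ∀ V : X.Opens, Function.Injective (MSections.app f φ V)) {c : CechMC1 f M U}
    {e' : CechMC2 f M' U} (he' : cechMapC2 f φ U e' = cechMD1 f M U c) :
    e' ∈ cechMZ2 f M' U := by
  rw [mem_cechMZ2_iff]
  funext i j k l
  apply hinj (U i ⊓ U j ⊓ U k ⊓ U l)
  have e := congrFun (congrFun (congrFun (congrFun (cechMD2_mapC2 f φ U e') i) j) k) l
  rw [cechMapC3_apply] at e
  rw [← e, he', cechMD2_cechMD1]
  simp only [Pi.zero_apply, map_zero]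

/-- If `im φ ⊇ ker ψ` on sections and `ψ e = 0` for a `2`-cochain `e` of `M`, then `e = φ e'`.
[cite: Hartshorne1977, III Thm. 4.5 proof p. 222 (PDF p. 278)] -/
theorem exists_mapC2_eq_of_mapC2_eq_zero
    (hex : ∀ (V : X.Opens) (m : MSections f M V), MSections.app f ψ V m = 0 →
      ∃ m' : MSections f M' V, MSections.app f φ V m' = m)
    {e : CechMC2 f M U} (he : cechMapC2 f ψ U e = 0) :
    ∃ e' : CechMC2 f M' U, cechMapC2 f φ U e' = e := by
  have key : ∀ i j k, ∃ e'ijk : MSections f M' (U i ⊓ U j ⊓ U k),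
      MSections.app f φ _ e'ijk = e i j k :=
    fun i j k => hex _ _ (by rw [← cechMapC2_apply f ψ U e i j k, he]; rfl)
  choose e' he' using key
  exact ⟨e', funext fun i => funext fun j => funext fun k => he' i j k⟩

namespace CechExactData

variable {f U φ ψ} (h : CechExactData f U φ ψ)
include h

/-- **Exactness at `Ȟ¹(𝒰, M″)` when `Ȟ²(𝒰, M′) = 0`** (the long exact sequence of the short exact
sequence of Čech complexes, Hartshorne III, proof of Thm. 4.5): if
moreover `ψ` is surjective on the sections over every `U_i ∩ U_j` and every `2`-cocycle of `M′` on
`𝒰` is a `2`-coboundary, then every class in `Ȟ¹(𝒰, M″)` lifts to `Ȟ¹(𝒰, M)`.  (Lift the cocycle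
`z″` to a cochain `c` of `M`; `ψ (d¹ c) = d¹ z″ = 0`, so `d¹ c = φ e′`; `e′` is a `2`-cocycle since
`φ (d² e′) = d² d¹ c = 0`; write `e′ = d¹ c′`; then `c - φ c′` is a cocycle of `M` mapping to `z″`.)
[cite: Hartshorne1977, III Thm. 4.5 proof p. 222 (PDF p. 278)] -/
theorem exists_cechMapH1_eq_of_cechMZ2_le
    (h2 : ∀ i j, Function.Surjective (MSections.app f ψ (U i ⊓ U j)))
    (hZ : cechMZ2 f M' U ≤ cechMB2 f M' U) (y'' : CechMH1 f M'' U) :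
    ∃ y : CechMH1 f M U, cechMapH1 f ψ U y = y'' := by
  obtain ⟨z'', rfl⟩ := CechMH1.mk_surjective f M'' U y''
  -- lift the cocycle `z″` componentwise to a cochain `c` of `M`
  have key : ∀ i j, ∃ cij : MSections f M (U i ⊓ U j),
      MSections.app f ψ _ cij = (z'' : CechMC1 f M'' U) i j := fun i j => h2 i j _
  choose c hc using key
  have hc1 : cechMapC1 f ψ U c = (z'' : CechMC1 f M'' U) :=
    funext fun i => funext fun j => by rw [cechMapC1_apply, hc]
  -- `ψ (d¹ c) = 0`, so `d¹ c = φ e′`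
  have hg : cechMapC2 f ψ U (cechMD1 f M U c) = 0 := by
    rw [← cechMD1_mapC1, hc1]
    exact (mem_cechMZ1_iff f M'' U _).mp z''.2
  obtain ⟨e', he'⟩ := exists_mapC2_eq_of_mapC2_eq_zero f U φ ψ h.exact hg
  -- `e′` is a `2`-cocycle, hence a `2`-coboundary `d¹ c′`
  have he'Z : e' ∈ cechMZ2 f M' U := mem_cechMZ2_of_mapC2_eq_cechMD1 f U φ h.injective he'
  obtain ⟨c', hc'⟩ := (mem_cechMB2_iff f M' U e').mp (hZ he'Z)
  -- the corrected cochain `c - φ c′` is a cocycle of `M` over `z″`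
  have hZ1 : c - cechMapC1 f φ U c' ∈ cechMZ1 f M U := by
    rw [mem_cechMZ1_iff, map_sub, cechMD1_mapC1, hc', he', sub_self]
  refine ⟨CechMH1.mk f M U ⟨_, hZ1⟩, ?_⟩
  rw [cechMapH1_mk]
  congr 1
  apply Subtype.ext
  rw [cechMapZ1_coe]
  change cechMapC1 f ψ U (c - cechMapC1 f φ U c') = (z'' : CechMC1 f M'' U)
  rw [map_sub, hc1, sub_eq_self]
  funext i j
  rw [cechMapC1_apply, cechMapC1_apply, h.app_app]
  rfl

/-- **`Ȟ¹` is right exact when `Ȟ²(𝒰, M′) = 0`**: under the hypotheses of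
`exists_cechMapH1_eq_of_cechMZ2_le`, with `Ȟ²(𝒰, M′)` subsingleton, the map
`Ȟ¹(𝒰, M) → Ȟ¹(𝒰, M″)` is surjective. [cite: Hartshorne1977, III Thm. 4.5 proof p. 222 (PDF p. 278)] -/
theorem cechMapH1_surjective_of_subsingleton_cechMH2
    (h2 : ∀ i j, Function.Surjective (MSections.app f ψ (U i ⊓ U j)))
    (hH2 : Subsingleton (CechMH2 f M' U)) : Function.Surjective (cechMapH1 f ψ U) :=
  fun y'' => h.exists_cechMapH1_eq_of_cechMZ2_le h2
    ((subsingleton_cechMH2_iff f M' U).mp hH2) y''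

end CechExactData

end Exact

end Literature.AlgebraicGeometry.Morphisms

end
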